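import Mathlib.Combinatorics.Hall.Basic
import Summits.ValiantsHypothesis.ValiantsHypothesis.Theorems.DivisionGapPerDivisionHardStubGreedyRows
import Summits.ValiantsHypothesis.ValiantsHypothesis.Theorems.DivisionGapPerDivisionHardStubSparseRigidFlow

/-!
# Crux `DivisionGap.PerDivisionHard` (stmt-ValiantsHypothesis-5065), line `pair-descent-jss-endpoint` —
stub `stub_keyPlacement`: a placement of `G(b,1) ⊕ M₀` whose face avoids a small cell set

`stub_keyPlacement`: if `2|K| + 2(b + b²) ≤ n` then some placement
`eR eC : BlockV b 1 m ≃ Fin n`, `m = n - (b + b²)`, of the block arsenal `G(b,1) ⊕ M₀`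
(`BlockV`, `blockAdj`, `placedBlock` of `Theorems/DivisionGapDefs.lean`) has no face cell in `K`.

Proof.  Let `N = b + b²`, `q = |K|`, so `m = n - N ≥ 2q`.  ACTIVE rows: an `N`-set `R` of rows
containing no row of a cell of `K` (`Finset.exists_subset_card_eq` in the complement of
`K.image Prod.fst`, which has `≥ n - q ≥ N` elements); the active columns are the SAME set `R`.
PADDING: a permutation `π` of the complement `Rᶜ` with `(r, π r) ∉ K` for every `r ∉ R`
(`exists_paddingMatching`) — Hall's marriage theorem
(`Finset.all_card_le_biUnion_card_iff_exists_injective`) for the relation "`(r, c) ∉ K`" on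
`Rᶜ × Rᶜ`: a set of `s ≤ q` padding rows has a member with `≥ m - q ≥ q ≥ s` admissible
padding columns, and a set of `s > q` padding rows admits EVERY padding column (a column
inadmissible for all of them would carry `s > q` cells of `K`); an injective self-map of a finite
type is a bijection.  LABELS (`exists_blockEquiv_padding`, `Equiv.sumCompl`): `eR` sends
the core and internal labels into `R` and the padding label `u` to `e₂ u ∈ Rᶜ`; `eC` sends the
core and internal labels into `R` and the padding label `u` to `π (e₂ u)`.  A face cell in a core or
internal row lies in a row of `R`, hence off `K`; the only face cell in the padding row `u` is
`(e₂ u, π (e₂ u)) ∉ K` (`adj_paddingRow`).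
-/

noncomputable section

-- `Summit.ValiantsHypothesis.ValiantsHypothesis.…` is the tree's mandated single-conjunct layout
-- (Sub = Summit), so the duplicated namespace component is intended.
set_option linter.dupNamespace false

namespace Summit.ValiantsHypothesis.ValiantsHypothesis.Theorems.DivisionGapPerDivisionHard

/-- **Labelling with prescribed padding.**  Given a `(b + b²k)`-set `R` of rows and a bijection
`e₂` of `Fin m` with the complement of `R`, there is a labelling `eR : BlockV b k m ≃ Fin n`
sending the core and the internal labels into `R` and the padding label `u` to `e₂ u`
(`Fintype.equivOfCardEq`, `Equiv.sumCongr`, `Equiv.sumCompl`). [folklore] -/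
theorem exists_blockEquiv_padding {n b k m : ℕ} (R : Finset (Fin n))
    (hR : R.card = b + b * (b * k)) (e₂ : Fin m ≃ {x // x ∉ R}) :
    ∃ eR : BlockV b k m ≃ Fin n, (∀ i, eR (Sum.inl i) ∈ R) ∧
      (∀ p, eR (Sum.inr (Sum.inl p)) ∈ R) ∧ ∀ u, eR (Sum.inr (Sum.inr u)) = e₂ u := by
  classical
  have h1 : Fintype.card (Fin b ⊕ (Fin b × Fin b × Fin k)) = Fintype.card {x // x ∈ R} := by
    simp only [Fintype.card_sum, Fintype.card_fin, Fintype.card_prod, Fintype.card_coe, hR]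
  let e₁ := Fintype.equivOfCardEq h1
  exact ⟨(Equiv.sumAssoc _ _ _).symm.trans
      ((e₁.sumCongr e₂).trans (Equiv.sumCompl (· ∈ R))),
    fun i => (e₁ (Sum.inl i)).2, fun p => (e₁ (Sum.inr p)).2, fun u => rfl⟩

/-- **The padding matching.**  If `2|K| + |R| ≤ n`, the complement of the row set `R` carries a
permutation `π` with no cell `(r, π r)` in `K`: Hall's marriage theorem
(`Finset.all_card_le_biUnion_card_iff_exists_injective`) for the relation "`(r, c) ∉ K`" on
`Rᶜ × Rᶜ` (`|Rᶜ| = n - |R| ≥ 2|K|`) — a set of `s ≤ |K|` padding rows has a member with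
`≥ n - |R| - |K| ≥ s` admissible columns, a set of `s > |K|` padding rows admits every column of
`Rᶜ` — and an injective self-map of a finite type is bijective. [folklore] -/
theorem exists_paddingMatching {n : ℕ} (K : Finset (Fin n × Fin n)) (R : Finset (Fin n))
    (hK : 2 * K.card + R.card ≤ n) :
    ∃ π : Equiv.Perm {x // x ∉ R},
      ∀ r : {x // x ∉ R}, ((r : Fin n), (π r : Fin n)) ∉ K := by
  classical
  -- the admissible padding columns of a padding row
  let t : {x // x ∉ R} → Finset (Fin n) := fun r => Rᶜ.filter fun c => ((r : Fin n), c) ∉ K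
  have hRc : (Rᶜ : Finset (Fin n)).card = n - R.card := by
    rw [Finset.card_compl, Fintype.card_fin]
  have ht : ∀ r, n - R.card - K.card ≤ (t r).card := by
    intro r
    have h1 : (Rᶜ.filter fun c => ((r : Fin n), c) ∈ K).card + (t r).card =
        (Rᶜ : Finset (Fin n)).card := Finset.card_filter_add_card_filter_not _
    have h2 : (Rᶜ.filter fun c => ((r : Fin n), c) ∈ K).card ≤ K.card :=
      calc (Rᶜ.filter fun c => ((r : Fin n), c) ∈ K).card ≤ (K.image Prod.snd).card :=
            Finset.card_le_card fun c hc =>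
              Finset.mem_image.2 ⟨((r : Fin n), c), (Finset.mem_filter.1 hc).2, rfl⟩
        _ ≤ K.card := Finset.card_image_le
    omega
  -- Hall's condition
  have hall : ∀ s : Finset {x // x ∉ R}, s.card ≤ (s.biUnion t).card := by
    intro s
    by_cases hs : s.card ≤ K.card
    · rcases s.eq_empty_or_nonempty with rfl | ⟨r, hr⟩
      · simp
      · calc s.card ≤ K.card := hs
          _ ≤ n - R.card - K.card := by omega
          _ ≤ (t r).card := ht r
          _ ≤ (s.biUnion t).card := Finset.card_le_card (Finset.subset_biUnion_of_mem t hr)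
    · have hsub : Rᶜ ⊆ s.biUnion t := by
        intro c hc
        by_contra hcs
        have hcK : ∀ r ∈ s, ((r : Fin n), c) ∈ K := fun r hr => by
          by_contra hrc
          exact hcs (Finset.mem_biUnion.2 ⟨r, hr, Finset.mem_filter.2 ⟨hc, hrc⟩⟩)
        refine hs ?_
        calc s.card = (s.image fun r : {x // x ∉ R} => ((r : Fin n), c)).card :=
              (Finset.card_image_of_injective _ fun r r' h =>
                Subtype.ext (congrArg Prod.fst h)).symm
          _ ≤ K.card := Finset.card_le_card fun e he => by
              obtain ⟨r, hr, rfl⟩ := Finset.mem_image.1 he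
              exact hcK r hr
      calc s.card ≤ Fintype.card {x // x ∉ R} := Finset.card_le_univ s
        _ = (Rᶜ : Finset (Fin n)).card := by
            rw [Fintype.card_subtype_compl, Fintype.card_fin, Fintype.card_coe, hRc]
        _ ≤ (s.biUnion t).card := Finset.card_le_card hsub
  obtain ⟨f, hf, hft⟩ := (Finset.all_card_le_biUnion_card_iff_exists_injective t).1 hall
  have hfR : ∀ r, f r ∉ R := fun r => Finset.mem_compl.1 (Finset.mem_filter.1 (hft r)).1
  have hπ : Function.Injective (fun r => ⟨f r, hfR r⟩ : {x // x ∉ R} → {x // x ∉ R}) :=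
    fun r r' h => hf (congrArg Subtype.val h)
  exact ⟨Equiv.ofBijective _ hπ.bijective_of_finite, fun r => (Finset.mem_filter.1 (hft r)).2⟩

/-- **`stub_keyPlacement` (line `pair-descent-jss-endpoint`, the KEY rung).**  If
`2|K| + 2(b + b²) ≤ n` there is a placement `eR eC` of `G(b,1) ⊕ M₀` whose face avoids `K`:
the `b + b²` active rows `R` are chosen off the rows of `K` (`Finset.exists_subset_card_eq`), the
active columns are `R` as well, the padding rows `Rᶜ` are paired with the padding columns `Rᶜ`
by a permutation avoiding `K` (`exists_paddingMatching`, Hall's theorem), and the labellings are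
assembled by `exists_blockEquiv_padding`; a face cell in a core or internal row lies in a row of
`R`, and the face cell of the padding row `u` is its matched cell (`adj_paddingRow`). [folklore] -/
theorem stub_keyPlacement :
    ∀ (b n : ℕ) (K : Finset (Fin n × Fin n)), 2 * K.card + 2 * (b + b * (b * 1)) ≤ n →
      ∃ eR eC : BlockV b 1 (n - (b + b * (b * 1))) ≃ Fin n, ∀ e ∈ placedBlock eR eC, e ∉ K := by
  intro b n K hK
  classical
  -- active rows (and columns): off the rows of `K`
  obtain ⟨R, hRK, hR⟩ : ∃ R ⊆ (K.image Prod.fst)ᶜ, R.card = b + b * (b * 1) :=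
    Finset.exists_subset_card_eq (by
      rw [Finset.card_compl, Fintype.card_fin]
      have := Finset.card_image_le (s := K) (f := Prod.fst)
      omega)
  have hrow : ∀ r ∈ R, ∀ c, (r, c) ∉ K := fun r hr c hrc =>
    Finset.mem_compl.1 (hRK hr) (Finset.mem_image.2 ⟨(r, c), hrc, rfl⟩)
  -- the padding matching and the two labellings
  obtain ⟨π, hπ⟩ := exists_paddingMatching K R (by omega)
  have h2 : Fintype.card (Fin (n - (b + b * (b * 1)))) = Fintype.card {x // x ∉ R} := by
    rw [Fintype.card_fin, Fintype.card_subtype_compl, Fintype.card_fin, Fintype.card_coe, hR]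
  let e₂ := Fintype.equivOfCardEq h2
  obtain ⟨eR, hR₁, hR₂, hR₃⟩ := exists_blockEquiv_padding R hR e₂
  obtain ⟨eC, -, -, hC₃⟩ := exists_blockEquiv_padding R hR (e₂.trans π)
  refine ⟨eR, eC, ?_⟩
  -- the placed face avoids `K`
  rintro ⟨r, c⟩ he
  simp only [placedBlock, Finset.mem_filter, Finset.mem_univ, true_and] at he
  obtain ⟨x, rfl⟩ := eR.surjective r
  obtain ⟨y, rfl⟩ := eC.surjective c
  simp only [Equiv.symm_apply_apply] at he
  rcases x with i | p | u
  · exact hrow _ (hR₁ i) _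
  · exact hrow _ (hR₂ p) _
  · rw [adj_paddingRow he, hR₃, hC₃, Equiv.trans_apply]
    exact hπ (e₂ u)

end Summit.ValiantsHypothesis.ValiantsHypothesis.Theorems.DivisionGapPerDivisionHard

end
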